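import Mathlib.Algebra.MonoidAlgebra.Support
import Mathlib.Algebra.FreeMonoid.Basic
import Mathlib.Algebra.BigOperators.Fin
import Literature.Computability.MetaComplexity.NCIPS
import Literature.Computability.MetaComplexity.Frege
import HarnessLib

/-!
# Route `CnfIdealGenLength` — definitions used by the proof of `FregeShortensGenLength` (stmt-PneNP-18886)

Proof-side vocabulary over the free associative algebra `R⟨x_i : i ∈ ν⟩ = MonoidAlgebra R (FreeMonoid ν)` of
`Literature.Computability.MetaComplexity.NCIPS` [LiTzameretWang2018, Def. 1.2, 1.3, 1.6, §1.3.3]: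

* `Repr R E r f` — `f` is a sum of AT MOST `r` single terms `u · g · v` with `g` a Boolean/commutator axiom
  (`NCIPS.IsAxiom`) and `wordDeg u, wordDeg v ≤ E`: the body of `NCIPS.HasBoundedRepr R E r φ` with the clause
  product replaced by an arbitrary element `f` and "exactly `r`" relaxed to "at most `r`" (padding lemma
  `hasBoundedRepr_of_repr` in the companion file `CnfIdealGenLengthFregeShortensGenLengthRepr`);
* `trForm w B` — the arithmetisation `tr` of `B : PropForm ℕ` [LiTzameretWang2018, Def. 1.3: value `0` = true,
  `tr(¬T) = 1 - tr T`, `tr(T₁ ∨ T₂) = tr T₁ · tr T₂`, `tr(T₁ ∧ T₂) = 1 - (1 - tr T₁)(1 - tr T₂)`] at an arbitrary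
  assignment `w` of algebra elements to the variables (so that substitution is composition);
* `leafLit w (i, b)` (`1 - w i` / `w i`) and the ordered products `leafProd w ρ` (point indicators, newest factor
  rightmost);
* `stdLeaf R n` — the standard leaves `x_i ↦ 1 - x_i` for `i < n` (the tree's polarity, `= litWord R (i, true)`),
  variables `≥ n` read as the constant false (`↦ 1`).

Only definitions and their unfolding lemmas live here; the calculus is in the `…FregeShortensGenLength*` files.
-/

set_option linter.dupNamespace false -- `Summit.PneNP.PneNP.…`: summit = sub-problem name (D-0017)

namespace Summit.PneNP.PneNP.Theorems.CnfIdealGenLength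

open Literature.Computability.Complexity
open Literature.Computability.MetaComplexity
open Literature.Computability.MetaComplexity.NCIPS

noncomputable section

universe u v

variable {R : Type u} [CommRing R] {ν : Type v}

variable (R)

/-! ### At most `r` single terms of cofactor degree `≤ E` -/

/-- `Repr R E r f`: `f ∈ R⟨x⟩` is a sum of at most `r` single terms `u_ρ · g_ρ · v_ρ` with every `g_ρ` a
Boolean axiom `x_i x_i - x_i` or a commutator axiom `x_i x_j - x_j x_i` (`NCIPS.IsAxiom`) and cofactors
of word degree `wordDeg u_ρ, wordDeg v_ρ ≤ E` (otherwise arbitrary). This is the body of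
`NCIPS.HasBoundedRepr R E r φ` with the clause product replaced by an arbitrary element `f` and "exactly
`r` terms" relaxed to "at most `r`" (equivalent up to zero padding, `hasBoundedRepr_of_repr`); the least
such `r` is the two-sided generation length of `f` at cofactor degree `E`.
[cite: LiTzameretWang2018, Def. 1.2 and §1.3.3 (ideal membership through the Boolean and commutator axioms)] -/
def Repr (E r : ℕ) (f : MonoidAlgebra R (FreeMonoid ν)) : Prop :=
  ∃ m : ℕ, m ≤ r ∧ ∃ u g v : Fin m → MonoidAlgebra R (FreeMonoid ν),
    (∀ ρ, IsAxiom (g ρ) ∧ wordDeg (u ρ) ≤ E ∧ wordDeg (v ρ) ≤ E) ∧ ∑ ρ, u ρ * g ρ * v ρ = f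

variable {R}

/-! ### Translation of propositional formulas -/

/-- The arithmetisation `tr` of a propositional formula with the variables sent to prescribed algebra
elements `w i` (value `0` = true, `1` = false at Boolean points): `tr(⊤) = 0`, `tr(⊥) = 1`,
`tr(¬B) = 1 - tr B`, `tr(B ∧ C) = 1 - (1 - tr B)(1 - tr C)`, `tr(B ∨ C) = tr B · tr C`. Taking `w`
general makes substitution a composition (`trForm_subst`). [cite: LiTzameretWang2018, Def. 1.3 (tr)] -/
def trForm (w : ℕ → MonoidAlgebra R (FreeMonoid ν)) : PropForm ℕ → MonoidAlgebra R (FreeMonoid ν)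
  | .var i => w i
  | .const true => 0
  | .const false => 1
  | .neg B => 1 - trForm w B
  | .conj B C => 1 - (1 - trForm w B) * (1 - trForm w C)
  | .disj B C => trForm w B * trForm w C

section trForm

variable (w : ℕ → MonoidAlgebra R (FreeMonoid ν))

/-- Unfolding `trForm` at a variable. [cite: LiTzameretWang2018, Def. 1.3] -/
@[simp] theorem trForm_var (i : ℕ) : trForm w (.var i) = w i := rfl

/-- Unfolding `trForm` at a constant. [cite: LiTzameretWang2018, Def. 1.3] -/
@[simp] theorem trForm_const (b : Bool) : trForm w (.const b) = if b then 0 else 1 := by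
  cases b <;> rfl

/-- Unfolding `trForm` at a negation. [cite: LiTzameretWang2018, Def. 1.3] -/
@[simp] theorem trForm_neg (B : PropForm ℕ) : trForm w (.neg B) = 1 - trForm w B := rfl

/-- Unfolding `trForm` at a conjunction. [cite: LiTzameretWang2018, Def. 1.3] -/
@[simp] theorem trForm_conj (B C : PropForm ℕ) :
    trForm w (.conj B C) = 1 - (1 - trForm w B) * (1 - trForm w C) := rfl

/-- Unfolding `trForm` at a disjunction. [cite: LiTzameretWang2018, Def. 1.3] -/
@[simp] theorem trForm_disj (B C : PropForm ℕ) : trForm w (.disj B C) = trForm w B * trForm w C := rfl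

end trForm

/-- The literal factor at a leaf assignment `w`: `(i, true) ↦ 1 - w i`, `(i, false) ↦ w i` (value `1` at a
Boolean point iff the point gives variable `i` the truth value `b`; for `w = stdLeaf` these are the two
letters `x_i`, `1 - x_i`). [cite: LiTzameretWang2018, Def. 1.6 (tr′ of a literal)] -/
def leafLit (w : ℕ → MonoidAlgebra R (FreeMonoid ν)) (l : ℕ × Bool) : MonoidAlgebra R (FreeMonoid ν) :=
  if l.2 then 1 - w l.1 else w l.1

/-- Ordered product of literal factors, NEWEST FACTOR RIGHTMOST: `leafProd w [] = 1`,
`leafProd w (l :: ρ) = leafProd w ρ * leafLit w l` — the indicator of the Boolean point `ρ` up to the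
Boolean/commutator axioms. [cite: LiTzameretWang2018, Def. 1.6 (products of tr′ of literals)] -/
def leafProd (w : ℕ → MonoidAlgebra R (FreeMonoid ν)) : List (ℕ × Bool) → MonoidAlgebra R (FreeMonoid ν)
  | [] => 1
  | l :: ρ => leafProd w ρ * leafLit w l

section leaf

variable (w : ℕ → MonoidAlgebra R (FreeMonoid ν))

/-- Unfolding `leafProd` on `[]`. [folklore] -/
@[simp] theorem leafProd_nil : leafProd w [] = 1 := rfl

/-- Unfolding `leafProd` on a cons. [folklore] -/
@[simp] theorem leafProd_cons (l : ℕ × Bool) (ρ : List (ℕ × Bool)) :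
    leafProd w (l :: ρ) = leafProd w ρ * leafLit w l := rfl

end leaf

variable (R)

/-- The standard leaves over `x_0, …, x_{n-1}` in the tree's polarity (`1` = true for the VARIABLE, value
`0` = true for the TRANSLATION): `x_i ↦ 1 - x_i` for `i < n` (`= litWord R (i, true)`), and variables
`≥ n` are read as the constant false (`↦ 1`). [cite: LiTzameretWang2018, Def. 1.3 and Def. 1.6 (up to the involution x ↦ 1 - x)] -/
def stdLeaf (n : ℕ) (i : ℕ) : MonoidAlgebra R (FreeMonoid (Fin n)) :=
  if h : i < n then 1 - X R (⟨i, h⟩ : Fin n) else 1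

variable {R}

/-- `stdLeaf` below `n` is the positive literal word. [cite: LiTzameretWang2018, Def. 1.6] -/
theorem stdLeaf_of_lt {n : ℕ} (i : Fin n) : stdLeaf R n i.val = 1 - X R i := by
  simp [stdLeaf, i.isLt]

end

end Summit.PneNP.PneNP.Theorems.CnfIdealGenLength
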